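import Mathlib
import Literature.RingTheory.TwoVariableSeries.Basic
import Summits.ResolutionOfSingularities.ResolutionOfSingularities.Theorems.WeightedInvariantLocalWeightedDropMonicDescentGraphCurveTools
import Summits.ResolutionOfSingularities.ResolutionOfSingularities.Theorems.WeightedInvariantLocalWeightedDropMonicDescentChartSubst

/-!
# `WeightedInvariant.LocalWeightedDrop`, sub-stub N4″: tools for the tail argument of T-5′ (column transfer; transports of re-centred labels)

Crux item stmt-ResolutionOfSingularities-8899 `LocalWeightedDrop` (route `ResolutionOfSingularities/WeightedInvariant`), door
`WeightedConstruction` stmt-ResolutionOfSingularities-0571.  [OURS · L1 W4.3, chain w43, lead prover; the "NEW small lemmas" of `N4PRIME-PLAN.md` §9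
(s4) for piece T-5′ `stub_monicDescentNoChain`.]

* `isPermissibleOne_of_wellPrepared_of_recentre` — COLUMN TRANSFER (mirror of the row transfer p489836): a well-prepared label one of whose re-centrings
  has `V(y,u₁)` permissible has it permissible itself (`exists_low_col_of_recentre`, p486315);
* `X_dvd_of_X_dvd_sq`, `X_dvd_recentring_of_isPermissibleOne` — in char 2, if `V(y,u₁)` is permissible before and after re-centring by `ψ` then `u₁ ∣ ψ`;
* `blowOne_recentre` — the `u₁`-chart of a re-centred label is the re-centring by `blowOne 1 ψ` of the `u₁`-chart label
  (`blowOne 2 (A₀ + A₁ψ + ψ²) = blowOne 2 A₀ + blowOne 1 A₁ · blowOne 1 ψ + (blowOne 1 ψ)²`);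
* `divOne_recentre` — `divOne 2 (A₀ + A₁(u₁ψ′) + (u₁ψ′)²) = divOne 2 A₀ + divOne 1 A₁ · ψ′ + ψ′²`.
-/

set_option linter.dupNamespace false -- mandated namespace of this single-conjunct summit

noncomputable section

namespace Summit.ResolutionOfSingularities.ResolutionOfSingularities.Theorems

namespace MonicDescent

open MvPowerSeries Literature.RingTheory.TwoVariableSeries

variable {k : Type} [Field k]

/-! ## Column transfer -/

/-- COLUMN TRANSFER: a WELL-PREPARED label one of whose re-centrings has `V(y,u₁)` permissible has `V(y,u₁)` permissible itself (char 2). -/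
theorem isPermissibleOne_of_wellPrepared_of_recentre [CharP k 2] {B₀ B₁ χ : MvPowerSeries (Fin 2) k}
    (hWP : WellPrepared B₀ B₁) (hperm : IsPermissibleOne (recentre χ B₀ B₁).1 (recentre χ B₀ B₁).2) :
    IsPermissibleOne B₀ B₁ := by
  rw [recentre_snd_eq] at hperm
  obtain ⟨hp₀, hp₁⟩ := hperm
  change ∀ d, coeff d (B₀ + B₁ * χ + χ ^ 2) ≠ 0 → 2 ≤ d 0 at hp₀
  refine ⟨fun d hd => ?_, hp₁⟩
  by_contra hlt
  push Not at hlt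
  have hne : (newtonSet B₀ B₁).Nonempty := ⟨d, Or.inl hd⟩
  obtain ⟨P, hP, hP0, hP1⟩ := exists_eq_betaL hne
  have hα : alphaL (newtonSet B₀ B₁) ≤ 1 := le_trans (alphaL_le (Or.inl hd)) (by omega)
  have hPodd : IsOdd B₀ B₁ P := hWP P (isVertex_lexMin hP hP0 hP1)
  rcases hPodd with ⟨e, rfl, he⟩ | ⟨hc, hi⟩
  · have := hp₁ e he
    simp only [Finsupp.smul_apply, smul_eq_mul] at hP0
    omega
  · obtain ⟨d', hd', hd'0⟩ := exists_low_col_of_recentre B₀ B₁ χ P hc hi (by omega)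
      (fun q hq => by
        have hq0 := alphaL_le (N := newtonSet B₀ B₁) (Or.inl hq)
        rcases Nat.lt_or_ge (P 0) (q 0) with h | h
        · exact Or.inl h
        · have hq0eq : q 0 = alphaL (newtonSet B₀ B₁) := by omega
          exact Or.inr ⟨by omega, by rw [hP1]; exact betaL_le (Or.inl hq) hq0eq⟩)
      (fun a ha => Or.inl (by have := hp₁ a ha; omega))
    have := hp₀ d' hd'
    omega

/-! ## Divisibility of the re-centring by `u₁` -/

/-- In characteristic 2, `u₁ ∣ ψ²` implies `u₁ ∣ ψ` (`(ψ²)_{2m} = ψ_m²`). -/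
theorem X_dvd_of_X_dvd_sq [CharP k 2] {ψ : MvPowerSeries (Fin 2) k} (h : X 0 ∣ ψ ^ 2) : X 0 ∣ ψ := by
  rw [X_dvd_iff] at h ⊢
  intro m hm
  by_contra hne
  have h2 := h (2 • m) (by simp [hm])
  rw [coeff_two_smul_sq] at h2
  exact hne (pow_eq_zero_iff (n := 2) (by norm_num) |>.mp h2)

/-- If `V(y,u₁)` is permissible for `(S₀, S₁)` and for its re-centring by `ψ`, then `u₁ ∣ ψ` (char 2). -/
theorem X_dvd_recentring_of_isPermissibleOne [CharP k 2] {S₀ S₁ ψ : MvPowerSeries (Fin 2) k}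
    (hS : IsPermissibleOne S₀ S₁) (hS' : IsPermissibleOne (S₀ + S₁ * ψ + ψ ^ 2) S₁) : X 0 ∣ ψ := by
  apply X_dvd_of_X_dvd_sq
  have h0 : X 0 ∣ S₀ := by
    rw [X_dvd_iff]; intro m hm
    by_contra hne; have := hS.1 m hne; omega
  have h1 : X 0 ∣ S₁ := by
    rw [X_dvd_iff]; intro m hm
    by_contra hne; have := hS.2 m hne; omega
  have h2 : X 0 ∣ S₀ + S₁ * ψ + ψ ^ 2 := by
    rw [X_dvd_iff]; intro m hm
    by_contra hne; have := hS'.1 m hne; omega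
  have : ψ ^ 2 = (S₀ + S₁ * ψ + ψ ^ 2) - S₀ - S₁ * ψ := by ring
  rw [this]
  exact dvd_sub (dvd_sub h2 h0) (h1.mul_right ψ)

/-! ## Transports of re-centred labels -/

/-- Exponent bound from an order bound. -/
theorem le_sum_of_le_order {A : MvPowerSeries (Fin 2) k} {c : ℕ} (hA : (c : ℕ∞) ≤ A.order) :
    ∀ e : Fin 2 →₀ ℕ, coeff e A ≠ 0 → c ≤ e 0 + e 1 := by
  intro e he
  by_contra hlt
  push Not at hlt
  apply he
  apply coeff_of_lt_order
  refine lt_of_lt_of_le ?_ hA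
  have hdeg : Finsupp.degree e = e 0 + e 1 := by rw [Finsupp.degree_eq_sum]; simp [Fin.sum_univ_two]
  rw [hdeg]
  exact_mod_cast hlt

/-- THE `u₁`-CHART OF A RE-CENTRED LABEL: `blowOne 2 (A₀ + A₁ψ + ψ²) = blowOne 2 A₀ + blowOne 1 A₁ · blowOne 1 ψ + (blowOne 1 ψ)²`
(orders: `A₀ ≥ 2`, `A₁ ≥ 1`, `ψ ≥ 1`). -/
theorem blowOne_recentre (A₀ A₁ ψ : MvPowerSeries (Fin 2) k) (h₀ : (2 : ℕ∞) ≤ A₀.order) (h₁ : (1 : ℕ∞) ≤ A₁.order)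
    (hψ : (1 : ℕ∞) ≤ ψ.order) :
    blowOne 2 (A₀ + A₁ * ψ + ψ ^ 2) = blowOne 2 A₀ + blowOne 1 A₁ * blowOne 1 ψ + blowOne 1 ψ ^ 2 := by
  have hσ : HasSubst ![(X 0 : MvPowerSeries (Fin 2) k), X 0 * X 1] := hasSubst_of_constantCoeff_zero constantCoeff_blowFamily
  have hsum : (2 : ℕ∞) ≤ (A₀ + A₁ * ψ + ψ ^ 2).order := by
    refine le_trans ?_ (MvPowerSeries.min_order_le_add)
    refine le_min (le_trans ?_ (MvPowerSeries.min_order_le_add)) ?_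
    · refine le_min h₀ (le_trans ?_ MvPowerSeries.le_order_mul)
      calc (2 : ℕ∞) = 1 + 1 := by norm_num
        _ ≤ A₁.order + ψ.order := add_le_add h₁ hψ
    · rw [pow_two]
      refine le_trans ?_ MvPowerSeries.le_order_mul
      calc (2 : ℕ∞) = 1 + 1 := by norm_num
        _ ≤ ψ.order + ψ.order := add_le_add hψ hψ
  apply X_pow_mul_left_cancel (c := 2)
  rw [X_pow_mul_blowOne 2 _ (le_sum_of_le_order hsum)]
  rw [← coe_substAlgHom hσ]
  simp only [map_add, map_mul, map_pow, coe_substAlgHom]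
  rw [← X_pow_mul_blowOne 2 A₀ (le_sum_of_le_order h₀), ← X_pow_mul_blowOne 1 A₁ (le_sum_of_le_order h₁),
    ← X_pow_mul_blowOne 1 ψ (le_sum_of_le_order hψ)]
  ring

/-- THE CURVE BLOW-UP OF A RE-CENTRED LABEL: for `ψ = u₁ψ′`, `divOne 2 (A₀ + A₁ψ + ψ²) = divOne 2 A₀ + divOne 1 A₁ · ψ′ + ψ′²`
(`u₁² ∣ A₀`, `u₁ ∣ A₁`). -/
theorem divOne_recentre (A₀ A₁ ψ' : MvPowerSeries (Fin 2) k) (h₀ : ∀ e : Fin 2 →₀ ℕ, coeff e A₀ ≠ 0 → 2 ≤ e 0)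
    (h₁ : ∀ e : Fin 2 →₀ ℕ, coeff e A₁ ≠ 0 → 1 ≤ e 0) :
    divOne 2 (A₀ + A₁ * (X 0 * ψ') + (X 0 * ψ') ^ 2) = divOne 2 A₀ + divOne 1 A₁ * ψ' + ψ' ^ 2 := by
  set R := divOne 2 A₀ + divOne 1 A₁ * ψ' + ψ' ^ 2 with hR
  have hfac : A₀ + A₁ * (X 0 * ψ') + (X 0 * ψ') ^ 2 = X 0 ^ 2 * R := by
    have hA0 : X 0 ^ 2 * divOne 2 A₀ = A₀ := X_pow_mul_divOne 2 A₀ h₀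
    have hA1 : X 0 ^ 1 * divOne 1 A₁ = A₁ := X_pow_mul_divOne 1 A₁ h₁
    calc A₀ + A₁ * (X 0 * ψ') + (X 0 * ψ') ^ 2
        = X 0 ^ 2 * divOne 2 A₀ + X 0 ^ 1 * divOne 1 A₁ * (X 0 * ψ') + (X 0 * ψ') ^ 2 := by rw [hA0, hA1]
      _ = X 0 ^ 2 * R := by rw [hR]; ring
  rw [hfac]
  apply X_pow_mul_left_cancel (c := 2)
  rw [X_pow_mul_divOne 2 (X 0 ^ 2 * R)]
  exact fun e he => by
    by_contra hlt
    push Not at hlt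
    exact he ((X_pow_dvd_iff.mp (Dvd.intro R rfl)) e hlt)

end MonicDescent

end Summit.ResolutionOfSingularities.ResolutionOfSingularities.Theorems

end
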